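import Summits.ResolutionOfSingularities.ResolutionOfSingularities.Theorems.SectionAscentAffineToGlobalRegularYardstick
import Summits.ResolutionOfSingularities.ResolutionOfSingularities.Theorems.SectionAscentAffineToGlobalYardstickChartsWeak
import Summits.ResolutionOfSingularities.ResolutionOfSingularities.Theorems.SectionAscentAffineToGlobalFibreBaseLocalization
import Summits.ResolutionOfSingularities.ResolutionOfSingularities.Theorems.SectionAscentAffineToGlobalPhasedPatching
import HarnessLib

/-!
# Crux `AffineToGlobal` (stmt-ResolutionOfSingularities-15961), line `Sketch`: the global
# theorem FIELD BY FIELD, from WEAK affine resolutions and the fibre kernel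

Route `ResolutionOfSingularities/SectionAscent`, crux `AffineToGlobal`. Support file
(`--supports stmt-ResolutionOfSingularities-15961`): the line's patching stated with exactly the
hypotheses it consumes, over ONE field `K` of any characteristic —

* `hweak`: every integral `K`-algebra of finite type has an ideal `I ≠ 0` with `Bl_I` regular
  (weak, blow-up-shaped resolutions of affine `K`-varieties; no condition over `Reg`);
* `hfib`: at every regular point `x` of every integral `K`-scheme of finite type, every blow-up
  of `Spec 𝒪_{X,x}` singular only over the closed point has a blow-up with regular source and
  centre over the closed point (the fibre kernel over `K`, all cases);

conclusion: every reduced separated `K`-scheme of finite type has a resolution of singularities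
(`hasResolution_of_affineBlowupResolutions_reduced`). Ingredients: weak yardstick charts
(`YardstickChartsWeak.yardstickCharts_of_affineBlowupResolutions`, p167841), phased patching
(`PhasedPatching.stub_phasedPatching`, p167416), fibre-form base localisation
(`FibreBaseLocalization.stub_fibreBaseLocalization`, p166978), and the landed projective
reduction (`WeightedThesis.ProjectiveIntegralSuffices`).

Sources: M. Temkin, Adv. Math. 219 (2008), Prop. 2.3.4 [Temkin2008]; The Stacks Project,
Tags 080A, 080B [StacksProject]; V. Cossart, O. Piltant, J. Algebra 529 (2019), Prop. 4.6
[CossartPiltant2019].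
-/

noncomputable section

set_option linter.dupNamespace false -- mandated namespace of this single-conjunct summit

open CategoryTheory CategoryTheory.Limits AlgebraicGeometry TopologicalSpace IsLocalRing
open Literature.AlgebraicGeometry.Resolution

namespace Summit.ResolutionOfSingularities.ResolutionOfSingularities.Theorems.AffineToGlobal.PhasedYardstickWeak

/-- **Resolution of a variety from weak affine resolutions and the fibre kernel, over one
field.** Let `K` be a field such that (a) every integral `K`-algebra of finite type has a
non-zero ideal with regular blow-up (every affine `K`-variety has a projective resolution, no
condition over its regular locus), and (b) at every regular point `x` of every integral
`K`-scheme of finite type, every blow-up of `Spec 𝒪_{X,x}` singular only over the closed point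
has a blow-up with regular source and centre over the closed point. Then every integral
`K`-scheme of finite type has a resolution of singularities: weak yardstick charts
(`YardstickChartsWeak.yardstickCharts_of_affineBlowupResolutions`), phased patching
(`PhasedPatching.stub_phasedPatching`), fibre-form base localisation
(`FibreBaseLocalization.stub_fibreBaseLocalization`). This is the line's global theorem with
exactly the hypotheses it consumes. [cite: Temkin2008, Prop. 2.3.4]
[cite: StacksProject, Tag 080A] -/
theorem hasResolution_of_affineBlowupResolutions (K : Type) [Field K]
    (hweak : ∀ (A : Type) [CommRing A] [IsDomain A] [Algebra K A] [Algebra.FiniteType K A],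
      ∃ I : Ideal A, I ≠ ⊥ ∧ Scheme.IsRegular (affineBlowup I))
    (hfib : ∀ (X : Scheme.{0}) [IsIntegral X] (f : X ⟶ Spec (.of K)) [LocallyOfFiniteType f]
      [QuasiCompact f] (x : X), x ∈ Scheme.regularLocus X →
      ∀ (S' : Scheme.{0}) (g : S' ⟶ Spec (X.presheaf.stalk x))
        (I : (Spec (X.presheaf.stalk x)).IdealSheafData), IsBlowup g I →
        (∀ s : S', s ∉ Scheme.regularLocus S' → g s = closedPoint (X.presheaf.stalk x)) →
        ∃ (S'' : Scheme.{0}) (g' : S'' ⟶ S') (I' : S'.IdealSheafData), IsBlowup g' I' ∧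
          (∀ s ∈ I'.support, g s = closedPoint (X.presheaf.stalk x)) ∧ Scheme.IsRegular S'')
    (Y : Scheme.{0}) [IsIntegral Y] (f : Y ⟶ Spec (.of K)) [LocallyOfFiniteType f]
    [QuasiCompact f] : Scheme.HasResolution Y := by
  obtain ⟨m, T, R, φ, hφ, b, 𝓘, fR, hRint, hRft, hRqc, S₀, σ₀, J, hcov, hb, hRreg, hJ, hσ₀,
    hcart⟩ := YardstickChartsWeak.yardstickCharts_of_affineBlowupResolutions K hweak Y f
  refine PhasedPatching.stub_phasedPatching K Y f m T R φ b 𝓘 hcov hb (fun i M π Q hπ => ?_)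
    S₀ σ₀ J hJ hσ₀ hcart
  haveI := hRint i
  haveI := hRft i
  haveI := hRqc i
  exact FibreBaseLocalization.stub_fibreBaseLocalization K (R i) (fR i)
    (fun x S' g I hg hs => hfib (R i) (fR i) x ((Scheme.mem_regularLocus x).mpr (hRreg i x))
      S' g I hg hs) M π Q hπ

/-- **Resolution of reduced separated schemes of finite type over `K` from weak affine
resolutions and the fibre kernel over `K`** (the `ResolutionInChar`-shaped conclusion, field
by field): `hasResolution_of_affineBlowupResolutions` and the landed projective reduction
`WeightedThesis.ProjectiveIntegralSuffices.stub_projectiveIntegralSuffices`.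
[cite: Temkin2008, Prop. 2.3.4] [cite: CossartPiltant2019, Prop. 4.6] -/
theorem hasResolution_of_affineBlowupResolutions_reduced (K : Type) [Field K]
    (hweak : ∀ (A : Type) [CommRing A] [IsDomain A] [Algebra K A] [Algebra.FiniteType K A],
      ∃ I : Ideal A, I ≠ ⊥ ∧ Scheme.IsRegular (affineBlowup I))
    (hfib : ∀ (X : Scheme.{0}) [IsIntegral X] (f : X ⟶ Spec (.of K)) [LocallyOfFiniteType f]
      [QuasiCompact f] (x : X), x ∈ Scheme.regularLocus X →
      ∀ (S' : Scheme.{0}) (g : S' ⟶ Spec (X.presheaf.stalk x))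
        (I : (Spec (X.presheaf.stalk x)).IdealSheafData), IsBlowup g I →
        (∀ s : S', s ∉ Scheme.regularLocus S' → g s = closedPoint (X.presheaf.stalk x)) →
        ∃ (S'' : Scheme.{0}) (g' : S'' ⟶ S') (I' : S'.IdealSheafData), IsBlowup g' I' ∧
          (∀ s ∈ I'.support, g s = closedPoint (X.presheaf.stalk x)) ∧ Scheme.IsRegular S'')
    (X : Scheme.{0}) (f : X ⟶ Spec (.of K)) (hsep : IsSeparated f)
    (hlft : LocallyOfFiniteType f) (hqc : QuasiCompact f) (hred : IsReduced X) :
    Scheme.HasResolution X := by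
  refine Theorems.WeightedThesis.ProjectiveIntegralSuffices.stub_projectiveIntegralSuffices K
    (fun n Y ι hι hint => ?_) X f hsep hlft hqc hred
  haveI := hι
  haveI := hint
  haveI : IsProper (Literature.AlgebraicGeometry.Motives.projectiveSpace n K).hom :=
    Literature.AlgebraicGeometry.Motives.isProper_projectiveSpace n K
  let fY : Y ⟶ Spec (.of K) := ι ≫ (Literature.AlgebraicGeometry.Motives.projectiveSpace n K).hom
  haveI : LocallyOfFiniteType fY := inferInstance
  haveI : QuasiCompact fY := inferInstance
  exact hasResolution_of_affineBlowupResolutions K hweak hfib Y fY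

end Summit.ResolutionOfSingularities.ResolutionOfSingularities.Theorems.AffineToGlobal.PhasedYardstickWeak

end
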